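import Summits.BirchSwinnertonDyer.BirchSwinnertonDyer.Theorems.ErratumRoadFiveBigRepLocalInputs
import Summits.BirchSwinnertonDyer.Rank1Residual.X11b.TorsionCohomologyControl
import Literature.NumberTheory.EllipticCurves.NeronOggShafarevichLocal
import Literature.NumberTheory.EllipticCurves.GoodReductionUnramifiedProofs
import Literature.NumberTheory.EllipticCurves.KodairaNeronUnramifiedInertiaProofs
import HarnessLib

/-!
# K2 crux 19270 `IMCDivAtErratumDataAll` (H3♭), ROAD FF — two ARITHMETIC inputs of Lemma 2.1 at the
# erratum's local data, discharged: (unr) Néron–Ogg–Shafarevich in `localMap` currency, and the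
# TRANSPORT of the fixed-torsion inputs from `E[p^∞]` to the congruent member `A_{g_m}` through (b)

Cell `bsd-stepL`, seat `bsd-stepL-imc-p1` (g8). `--supports stmt-BirchSwinnertonDyer-19270 --as helper`.
HONEST FRAMING: BSD is not proved for any pair by this file; it closes no item; no definition, no
named fact, no `sorry`. Sequel of p479748 ∕ p480662 ∕ p481719 (same seat, same night).

## What this file proves

p481719 (`hloc_anticyclotomicBigRep`, `divisibleInvariants_localMap_strictSet`) left three
arithmetic inputs as hypotheses in their natural form. Two of them are settled here for EVERY datum:

* §1 **(unr) for `E`** — `smul_eq_of_mem_absInertia_of_hasGoodReductionAt` ∕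
  **`smul_primaryTorsion_eq_of_mem_absInertia_of_hasGoodReductionAt`**: at a finite place `w` of
  GOOD reduction with `w ∤ p`, the inertia group `I_{K_w} ⊂ Γ_{K_w} → Γ_K` (defn-ty1's
  `localMap K (Sum.inr w)`, i.e. `absGaloisRestrict K K_w` on `absInertia K_w`) acts trivially on
  `E[p^∞]` — Silverman VII.4.1(b), the tree's `smul_eq_of_mem_inertia_of_zsmul_eq_zero`, moved from
  the ideal-theoretic inertia `𝔓.inertia Γ_K` to the local group by the tree's
  `resGalOfEmb_mem_inertia_primeBelow` (Neukirch II (9.6)) + `inertia_eq_absInertia` +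
  `resGalOfEmb_eq_of_apply_eq` (the chosen restriction `absGaloisRestrict` IS `res_ι` for the chosen
  embedding). Hence **`hunr_primaryTorsionGaloisRep_of_hasGoodReductionAt`**: the (unr) hypothesis of
  `hloc_anticyclotomicBigRep` holds for every `Σ` containing the places of bad reduction.
* §2 **transport through (b)** — `forall_fixed_torsion_eq_zero_of_equiv`: an `𝒪`-linear
  `G`-equivariant `e : A[r] ≃ A'[r]` (the erratum's (b) on `A = V/T`, the F2 datum) carries "no nonzero
  fixed `r`-torsion" from `A'` to `A` for any family of group elements; with the reduction
  `forall_fixed_primary_eq_zero_of_torsion` ("no fixed `p`-power torsion" ⟸ "no fixed `p`-torsion",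
  any `ContinuousRep`) and `r = p^m`, `m ≥ 1` (`forall_fixed_primary_eq_zero_of_equiv_pow`), the
  Lemma-2.1 inputs (dec)/(glob) for the MEMBER `A_{g_m}` follow from those for `E[p^∞]`
  ("`ρ̄_{g_m} ≅ ρ̄_E`": `E(K)[p] = 0`, `E(K_𝔭)[p] = 0`) — no separate fact about `g_m` is needed.

Pure bookkeeping on tree objects; CONDITIONAL on nothing; closes nothing. Remaining arithmetic
inputs of the assembly (next file): `E(K)[p] = 0` from irreducibility and `E(K_𝔭)[p] = 0` from (iv)
`E(ℚ_p)[p] = 0` (`K_𝔭 = ℚ_p`), in `absGaloisRestrict` currency.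

References: [Castella2018Erratum] Lemma 2.1 and (b) (pp. 2, 4); [SilvermanAEC2009] VII.4.1(b);
[NeukirchANT1999] II (9.6); [Skinner2016PacificMC] §2.6 (2-6-1), §3.1 (b), (d).
-/

noncomputable section

open PowerSeries Field IsDedekindDomain NumberField
  Literature.NumberTheory.GaloisRepresentations Literature.NumberTheory.EllipticCurves
  Literature.NumberTheory.EllipticCurves.BigRepModule
  Summit.BirchSwinnertonDyer.Rank1Residual.X11b.TorsionControl

universe u

namespace Summit.BirchSwinnertonDyer.Rank1Residual.X11b.BigRep

/-! ### §1 (unr): inertia at a good place `w ∤ p` acts trivially on `E[p^∞]`, `localMap` currency -/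

section Unramified

variable {K : Type u} [Field K] [NumberField K] (W : WeierstrassCurve K) [W.IsElliptic]

omit [NumberField K] [W.IsElliptic] in
/-- **The chosen restriction IS `res_ι` for the chosen embedding**: `absGaloisRestrict K L σ =
resGalOfEmb (absClosureEmbedding K L) σ` (both are characterised by `ι (τ • x) = σ • ι x`,
`absGaloisRestrict_apply_smul` ∕ `resGalOfEmb_eq_of_apply_eq`). [cite: MilneFT2022, Ch. 7 (restriction to the absolute Galois group of a subfield, well defined by the embedding)] -/
theorem resGalOfEmb_absClosureEmbedding_eq (L : Type u) [Field L] [Algebra K L]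
    (σ : absoluteGaloisGroup L) :
    resGalOfEmb (absClosureEmbedding K L) σ = absGaloisRestrict K L σ :=
  resGalOfEmb_eq_of_apply_eq (absClosureEmbedding K L) fun x => absGaloisRestrict_apply_smul K L σ x

/-- **Silverman VII.4.1(b) in `localMap` currency.** At a finite place `w` of good reduction and for
`n` prime to `w`, every `σ` in the inertia group `I_{K_w} ⊂ Γ_{K_w}`, restricted to `Γ_K` along the
chosen embedding (`absGaloisRestrict K K_w`, defn-ty1's `localMap K (Sum.inr w)`), fixes every
`P ∈ E(K̄)` with `n P = O`. [cite: SilvermanAEC2009, Prop. VII.4.1(b)] [cite: NeukirchANT1999, Ch. II §9 Prop. (9.6)] -/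
theorem smul_eq_of_mem_absInertia_of_hasGoodReductionAt {w : HeightOneSpectrum (𝓞 K)}
    (hv : W.HasGoodReductionAt w) {n : ℤ} (hn : (n : 𝓞 K) ∉ w.asIdeal)
    {σ : absoluteGaloisGroup (w.adicCompletion K)} (hσ : σ ∈ absInertia (w.adicCompletion K))
    {P : W.geomPoints} (hP : n • P = 0) :
    absGaloisRestrict K (w.adicCompletion K) σ • P = P := by
  obtain ⟨𝔐, h𝔐⟩ := w.localPrimesAbove_nonempty
  obtain ⟨val, hval⟩ := w.exists_spectralValuation
  have hσ' : σ ∈ 𝔐.inertia (absoluteGaloisGroup (w.adicCompletion K)) := by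
    rw [HeightOneSpectrum.inertia_eq_absInertia hval h𝔐]
    exact hσ
  have hmem := w.resGalOfEmb_mem_inertia_primeBelow (absClosureEmbedding K (w.adicCompletion K)) 𝔐 hσ'
  rw [resGalOfEmb_absClosureEmbedding_eq] at hmem
  exact W.smul_eq_of_mem_inertia_of_zsmul_eq_zero hv hn
    (HeightOneSpectrum.primeBelow_mem_primesAbove h𝔐) hmem hP

variable (p : ℕ)

omit [NumberField K] [W.IsElliptic] in
/-- `p^k` is prime to `w` when `p` is. [folklore] -/
theorem natCast_pow_notMem_of_notMem {w : HeightOneSpectrum (𝓞 K)} (hpw : ((p : ℕ) : 𝓞 K) ∉ w.asIdeal)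
    (k : ℕ) : (((p : ℤ) ^ k : ℤ) : 𝓞 K) ∉ w.asIdeal := by
  rw [Int.cast_pow, Int.cast_natCast]
  exact fun h => hpw (w.isPrime.mem_of_pow_mem k h)

/-- **(unr) for `E[p^∞]`**: at a finite place `w ∤ p` of good reduction, `I_{K_w}` (restricted along
`absGaloisRestrict K K_w`) acts trivially on `E[p^∞] = PrimaryTorsion W.geomPoints p`.
[cite: SilvermanAEC2009, Prop. VII.4.1(b)] -/
theorem smul_primaryTorsion_eq_of_mem_absInertia_of_hasGoodReductionAt {w : HeightOneSpectrum (𝓞 K)}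
    (hv : W.HasGoodReductionAt w) (hpw : ((p : ℕ) : 𝓞 K) ∉ w.asIdeal)
    {σ : absoluteGaloisGroup (w.adicCompletion K)} (hσ : σ ∈ absInertia (w.adicCompletion K))
    (P : PrimaryTorsion W.geomPoints p) :
    absGaloisRestrict K (w.adicCompletion K) σ • P = P := by
  obtain ⟨k, hk⟩ := P.exists_pow_smul_eq_zero
  refine PrimaryTorsion.ext ?_
  rw [PrimaryTorsion.val_gsmul]
  refine smul_eq_of_mem_absInertia_of_hasGoodReductionAt W hv
    (natCast_pow_notMem_of_notMem p hpw k) hσ (n := (p : ℤ) ^ k) ?_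
  rw [← Int.natCast_pow, natCast_zsmul]
  exact hk

/-- **The (unr) hypothesis of `hloc_anticyclotomicBigRep` (p481719) DISCHARGED** for every set `Σ`
containing the places of bad reduction: at `w ∉ Σ`, `w ∤ p`, `E` has good reduction, so inertia
acts trivially on `E[p^∞]` ("Suppose `Σ` contains all primes `v ∤ p` where `T_g` is ramified",
erratum Lemma 2.1). [cite: Castella2018Erratum, Lemma 2.1 (p. 2)] [cite: SilvermanAEC2009, Prop. VII.4.1(b)] -/
theorem hunr_primaryTorsionGaloisRep_of_hasGoodReductionAt (S : Set (HeightOneSpectrum (𝓞 K)))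
    (hS : ∀ w : HeightOneSpectrum (𝓞 K), w ∉ S → W.HasGoodReductionAt w) :
    ∀ w : HeightOneSpectrum (𝓞 K), w ∉ S → ((p : ℕ) : 𝓞 K) ∉ w.asIdeal →
      ∀ σ : absoluteGaloisGroup (w.adicCompletion K), σ ∈ absInertia (w.adicCompletion K) →
        ∀ P : PrimaryTorsion W.geomPoints p, absGaloisRestrict K (w.adicCompletion K) σ • P = P :=
  fun w hw hpw _ hσ P =>
    smul_primaryTorsion_eq_of_mem_absInertia_of_hasGoodReductionAt W p (hS w hw) hpw hσ P

end Unramified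

/-! ### §2 Transport of the fixed-torsion inputs through (b) `e : A[r] ≃ A'[r]` -/

section Transport

universe v

variable {𝒪 : Type*} [CommRing 𝒪] [TopologicalSpace 𝒪]
  {A : Type v} [AddCommGroup A] [Module 𝒪 A] [TopologicalSpace A]
  {A' : Type v} [AddCommGroup A'] [Module 𝒪 A'] [TopologicalSpace A']
  {G : Type v} [Group G] [TopologicalSpace G] {ι : Type*}

/-- **Transport of "no nonzero fixed `r`-torsion" through an equivariant `e : A[r] ≃ A'[r]`.** If no
nonzero element of `A'` killed by `r` is fixed by the family `(g i)` (acting through `ρ'`), the same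
holds for `A` (through `ρ`): a fixed `r`-torsion `a ∈ A` gives the fixed `r`-torsion `e a ∈ A'`. For
the erratum: `e` = (b) "`T_{g_m}/p^m ≃ T/p^m` as `𝒪[G_ℚ]`-modules" read on `A = V/T`, so the
Lemma-2.1 inputs for the member `A_{g_m}` come from those for `E[p^∞]` ("(d) `ρ̄_{f_m} ≅ ρ̄_f`").
[cite: Castella2018Erratum, §2 p. 4 (b) and Lemma 2.1] [cite: Skinner2016PacificMC, §3.1 (b), (d)] -/
theorem forall_fixed_torsion_eq_zero_of_equiv (ρ : ContinuousRep G 𝒪 A) (ρ' : ContinuousRep G 𝒪 A')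
    {r : 𝒪} (e : Submodule.torsionBy 𝒪 A r ≃ₗ[𝒪] Submodule.torsionBy 𝒪 A' r)
    (he : ∀ (g : G) (a : Submodule.torsionBy 𝒪 A r), (e (torsionRep ρ r g a) : A') = ρ' g (e a : A'))
    (g : ι → G) (h' : ∀ a' : A', (∀ i, ρ' (g i) a' = a') → r • a' = 0 → a' = 0) :
    ∀ a : A, (∀ i, ρ (g i) a = a) → r • a = 0 → a = 0 := by
  intro a ha hr
  set x : Submodule.torsionBy 𝒪 A r := ⟨a, (Submodule.mem_torsionBy_iff r a).2 hr⟩ with hx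
  have hfix : ∀ i, torsionRep ρ r (g i) x = x := fun i =>
    Subtype.ext (by rw [torsionRep_apply_coe]; exact ha i)
  have hex : (e x : A') = 0 := by
    refine h' _ (fun i => ?_) ((Submodule.mem_torsionBy_iff r _).1 (e x).2)
    rw [← he, hfix i]
  have hx0 : x = 0 := e.injective (Subtype.ext (by rw [hex, map_zero, Submodule.coe_zero]))
  exact congrArg Subtype.val hx0

variable {p : ℕ}

/-- **"No fixed `p`-power torsion" ⟸ "no fixed `p`-torsion"** for a continuous representation and any
family of group elements (if `a` is fixed with `p^{k+1} a = 0` then `p • a` is fixed with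
`p^k (p • a) = 0`; induction). The shape consumed by p479748's criteria is the `p`-power one.
[cite: Castella2018Erratum, Lemma 2.1, proof (p. 2: "vanishes when so does H⁰(K_𝔭, A_g[ϖ])")] -/
theorem forall_fixed_primary_eq_zero_of_torsion (ρ : ContinuousRep G 𝒪 A) (g : ι → G)
    (h : ∀ a : A, (∀ i, ρ (g i) a = a) → p • a = 0 → a = 0) :
    ∀ a : A, (∀ i, ρ (g i) a = a) → (∃ k : ℕ, p ^ k • a = 0) → a = 0 := by
  suffices key : ∀ (k : ℕ) (a : A), (∀ i, ρ (g i) a = a) → p ^ k • a = 0 → a = 0 by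
    rintro a ha ⟨k, hk⟩
    exact key k a ha hk
  intro k
  induction k with
  | zero => intro a _ hk; rwa [pow_zero, one_smul] at hk
  | succ k ih =>
    intro a ha hk
    have hpa : p • a = 0 := ih (p • a) (fun i => by rw [← Nat.cast_smul_eq_nsmul 𝒪, map_smul, ha i])
      (by rw [← mul_smul, ← pow_succ, hk])
    exact h a ha hpa

/-- **The Lemma-2.1 fixed-torsion input for a congruent member from the one for `E`.** Given (b) at
level `m ≥ 1` as an equivariant `e : A[p^m] ≃ A'[p^m]` and "no nonzero `(g i)`-fixed `p`-TORSION in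
`A'`", there is no nonzero `(g i)`-fixed `p`-POWER torsion in `A` — the hypothesis shape of
`divisibleInvariants_bigRep` ∕ `divisibleInvariants_localMap_strictSet` for the member `A = A_{g_m}`,
from `E(K)[p] = 0` ∕ `E(K_𝔭)[p] = 0` for `A' = E[p^∞]`.
[cite: Castella2018Erratum, §2 p. 4 (a)(b) and Lemma 2.1] [cite: Skinner2016PacificMC, §3.1 (d) ("ρ̄_{f_m} ≅ ρ̄_f is irreducible")] -/
theorem forall_fixed_primary_eq_zero_of_equiv_pow [Fact p.Prime] (ρ : ContinuousRep G 𝒪 A)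
    (ρ' : ContinuousRep G 𝒪 A') {m : ℕ} (hm : 1 ≤ m)
    (e : Submodule.torsionBy 𝒪 A ((p : 𝒪) ^ m) ≃ₗ[𝒪] Submodule.torsionBy 𝒪 A' ((p : 𝒪) ^ m))
    (he : ∀ (g : G) (a : Submodule.torsionBy 𝒪 A ((p : 𝒪) ^ m)),
      (e (torsionRep ρ ((p : 𝒪) ^ m) g a) : A') = ρ' g (e a : A'))
    (g : ι → G) (h' : ∀ a' : A', (∀ i, ρ' (g i) a' = a') → p • a' = 0 → a' = 0) :
    ∀ a : A, (∀ i, ρ (g i) a = a) → (∃ k : ℕ, p ^ k • a = 0) → a = 0 := by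
  refine forall_fixed_primary_eq_zero_of_torsion ρ g fun a ha hpa => ?_
  -- a fixed `p`-torsion element is fixed `p^m`-torsion (`m ≥ 1`); transport it through `e`
  refine forall_fixed_torsion_eq_zero_of_equiv ρ ρ' e he g (fun a' ha' hr => ?_) a ha ?_
  · -- in `A'`: `p^m a' = 0` and fixed ⇒ `a' = 0`, by the `p`-power form of `h'`
    exact forall_fixed_primary_eq_zero_of_torsion ρ' g h' a' ha'
      ⟨m, by rw [← Nat.cast_smul_eq_nsmul 𝒪, Nat.cast_pow]; exact hr⟩
  · obtain ⟨k, rfl⟩ := Nat.exists_eq_add_of_le hm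
    rw [pow_add, pow_one, mul_comm, mul_smul, Nat.cast_smul_eq_nsmul, hpa, smul_zero]

end Transport

end Summit.BirchSwinnertonDyer.Rank1Residual.X11b.BigRep

end
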